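import Mathlib
import HarnessLib

/-!
# The deformation profile of Richthammer's generalised translation (Richthammer 2007, §5.2, (6.15))

Companion of `HardDiskTranslationInvarianceSteps.lean` (provefact
`Literature.Barriers.AtomisticToContinuum.HardDisk.Richthammer2007_hardDisk`): the one-dimensional
profile `t_n` of the Mermin–Wagner deformation `𝔗_n⁰(x) = x + t_n(|x|) e₁` [Richthammer2007,
§5.2], and its elementary properties, all proved:

* `qFun s = q(s) := 1 / (1 ∨ s log s)`, `QFun k = Q(k) := ∫₀ᵏ q`,
  `rFun s k = r(s, k) := ∫_{(s ∨ 0) ∧ k}^k q / Q(k)`, `tProfile τ R n s = t_n(s) := τ r(s - R, n - R)`;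
* `qFun_pos`, `qFun_le_one`, `qFun_eq_one_of_nonpos`, `qFun_antitone`, `mul_qFun_le_two`
  (`0 < q ≤ 1`, `q` decreasing, `s q(s) ≤ 2` — the facts used in §6.8);
* `QFun_pos`, `QFun_mono`, `loglog_le_QFun` (`log log k ≤ Q(k)`), `tendsto_QFun_atTop`
  ("`lim Q(n) = ∞`, which is a consequence of `log log n ≤ Q(n)` for `n > 1`", §6.8);
* (5.2): `tProfile_eq_of_le` (`t_n = τ` on `s ≤ R`), `tProfile_eq_zero_of_le` (`t_n = 0` on
  `s ≥ n`), `tProfile_antitone` (`t_n` is decreasing), `tProfile_mem_Icc` (`0 ≤ t_n ≤ τ`);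
* (6.15): `rFun_sub_rFun_bounds` — for `u ≤ u'`, `u ≤ k`, `k > 0` (printed: `u = s - R`,
  `u' = s' - R`, `k = n - R`), `0 ≤ r(u, k) - r(u', k) ≤ (u'-u) q(u)/Q(k)` "by the monotonicity of
  `q`", whence the Lipschitz bounds `tProfile_sub_bounds`, `abs_tProfile_sub_le` on `t_n`.

Pure real analysis (Mathlib only); the two-dimensional estimates (6.16)–(6.18) that combine the
profile with the boxes `Λ_n` are kept for the file on the bad-configuration estimates.

## References

* [Richthammer2007] T. Richthammer, *Translation-invariance of two-dimensional Gibbsian point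
  processes*, Comm. Math. Phys. 274 (2007) 81–122, arXiv:0706.3637: §5.2 (p. 11, `q`, `Q`, `r`,
  `t_n`, (5.2)), §6.8 (p. 17, (6.15), "`s q(s) ≤ 2`", "`log log n ≤ Q(n)`").
-/

noncomputable section

open MeasureTheory Set Filter intervalIntegral
open scoped Topology

namespace Literature.Barriers.AtomisticToContinuum.HardDisk

/-! ### The density `q` -/

/-- `q(s) := 1 / (1 ∨ (s log s))` (Richthammer 2007, §5.2). [cite: Richthammer2007, §5.2 (p. 11)] -/
def qFun (s : ℝ) : ℝ := 1 / max 1 (s * Real.log s)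

/-- `q > 0`. [cite: Richthammer2007, §5.2 (p. 11)] -/
theorem qFun_pos (s : ℝ) : 0 < qFun s :=
  one_div_pos.2 (lt_of_lt_of_le one_pos (le_max_left _ _))

/-- `q ≤ 1` ("we used `q ≤ 1`", §6.8). [cite: Richthammer2007, §6.8 (p. 17)] -/
theorem qFun_le_one (s : ℝ) : qFun s ≤ 1 := by
  unfold qFun
  rw [div_le_one (lt_of_lt_of_le one_pos (le_max_left _ _))]
  exact le_max_left _ _

/-- `q(s) = 1` as long as `s log s ≤ 1`. [folklore] -/
theorem qFun_eq_one_of_mul_log_le {s : ℝ} (hs : s * Real.log s ≤ 1) : qFun s = 1 := by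
  unfold qFun
  rw [max_eq_left hs, div_one]

/-- `q(s) = 1/(s log s)` as soon as `s log s ≥ 1`. [folklore] -/
theorem qFun_eq_of_le_mul_log {s : ℝ} (hs : 1 ≤ s * Real.log s) : qFun s = 1 / (s * Real.log s) := by
  unfold qFun
  rw [max_eq_right hs]

/-- `u log u ≥ -1` for `u ≥ 0` (from `1 - 1/u ≤ log u`). [folklore] -/
theorem neg_one_le_mul_log {u : ℝ} (hu : 0 ≤ u) : -1 ≤ u * Real.log u := by
  rcases eq_or_lt_of_le hu with rfl | hu0
  · simp
  · have h := Real.one_sub_inv_le_log_of_pos hu0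
    have : u * (1 - u⁻¹) ≤ u * Real.log u := mul_le_mul_of_nonneg_left h hu
    have hu1 : u * (1 - u⁻¹) = u - 1 := by field_simp
    linarith

/-- `s log s ≤ 1` for `s ≤ 0` (with `Real.log s = log |s|`), so that `q = 1` on `]-∞, 0]`. [folklore] -/
theorem mul_log_le_one_of_nonpos {s : ℝ} (hs : s ≤ 0) : s * Real.log s ≤ 1 := by
  have h := neg_one_le_mul_log (neg_nonneg.2 hs)
  rw [Real.log_neg_eq_log] at h
  linarith

/-- `q = 1` on `]-∞, 0]`. [folklore] -/
theorem qFun_eq_one_of_nonpos {s : ℝ} (hs : s ≤ 0) : qFun s = 1 :=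
  qFun_eq_one_of_mul_log_le (mul_log_le_one_of_nonpos hs)

/-- `q = 1` on `[0, 1]` as well. [folklore] -/
theorem qFun_eq_one_of_le_one {s : ℝ} (hs0 : 0 ≤ s) (hs : s ≤ 1) : qFun s = 1 :=
  qFun_eq_one_of_mul_log_le ((mul_nonpos_of_nonneg_of_nonpos hs0 (Real.log_nonpos hs0 hs)).trans zero_le_one)

/-- **`q` is decreasing** ("by the monotonicity of `q`", §6.8): `s log s` is increasing on
`[1, ∞[` and `q = 1` before. [cite: Richthammer2007, §6.8 (p. 17)] -/
theorem qFun_antitone : Antitone qFun := by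
  intro a b hab
  -- `max 1 (a log a) ≤ max 1 (b log b)`
  have key : max 1 (a * Real.log a) ≤ max 1 (b * Real.log b) := by
    rcases le_or_gt a 1 with ha1 | ha1
    · have ha : a * Real.log a ≤ 1 := by
        rcases le_or_gt a 0 with ha0 | ha0
        · exact mul_log_le_one_of_nonpos ha0
        · exact (mul_nonpos_of_nonneg_of_nonpos ha0.le (Real.log_nonpos ha0.le ha1)).trans zero_le_one
      rw [max_eq_left ha]
      exact le_max_left _ _
    · have hb1 : 1 < b := lt_of_lt_of_le ha1 hab
      exact max_le_max le_rfl (mul_le_mul hab (Real.log_le_log (by linarith) hab)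
        (Real.log_nonneg ha1.le) (by linarith))
  unfold qFun
  exact one_div_le_one_div_of_le (lt_of_lt_of_le one_pos (le_max_left _ _)) key

/-- `q` is continuous. [folklore] -/
theorem continuous_qFun : Continuous qFun := by
  unfold qFun
  exact continuous_const.div (continuous_const.max Real.continuous_mul_log)
    fun s => ne_of_gt (lt_of_lt_of_le one_pos (le_max_left _ _))

/-- `q` is interval integrable. [folklore] -/
theorem intervalIntegrable_qFun (a b : ℝ) : IntervalIntegrable qFun volume a b :=
  continuous_qFun.intervalIntegrable a b

/-- **`s q(s) ≤ 2`** for `s ≥ 0` (§6.8). [cite: Richthammer2007, §6.8 (p. 17)] -/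
theorem mul_qFun_le_two {s : ℝ} (hs : 0 ≤ s) : s * qFun s ≤ 2 := by
  have hexp : Real.exp (1 / 2) < 2 := by
    have h1 := Real.exp_one_lt_d9
    have h2 : Real.exp (1 / 2) ^ 2 = Real.exp 1 := by
      rw [← Real.exp_nat_mul]; norm_num
    nlinarith [Real.exp_pos (1 / 2)]
  rcases le_or_gt (s * Real.log s) 1 with h | h
  · rw [qFun_eq_one_of_mul_log_le h, mul_one]
    by_contra hs2
    push Not at hs2
    have hl : (1 / 2 : ℝ) < Real.log s :=
      lt_of_lt_of_le (by linarith [Real.log_two_gt_d9]) (Real.log_le_log two_pos hs2.le)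
    have : 1 < s * Real.log s := by nlinarith
    linarith
  · have hspos : 0 < s := by
      rcases eq_or_lt_of_le hs with rfl | h0
      · norm_num at h
      · exact h0
    have hlog : 1 / 2 ≤ Real.log s := by
      by_contra hlt
      push Not at hlt
      have hs' : s < Real.exp (1 / 2) := by rwa [← Real.log_lt_iff_lt_exp hspos]
      have : s * Real.log s < 1 := by
        rcases le_or_gt 0 (Real.log s) with hl0 | hl0
        · calc s * Real.log s ≤ 2 * Real.log s := mul_le_mul_of_nonneg_right (hs'.trans hexp).le hl0
            _ < 2 * (1 / 2) := by linarith
            _ = 1 := by norm_num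
        · linarith [mul_neg_of_pos_of_neg hspos hl0]
      linarith
    rw [qFun_eq_of_le_mul_log h.le]
    have hlpos : 0 < Real.log s := by linarith
    calc s * (1 / (s * Real.log s)) = 1 / Real.log s := by field_simp
      _ ≤ 2 := by rw [div_le_iff₀ hlpos]; linarith

/-! ### The normalisation `Q` -/

/-- `Q(k) := ∫₀ᵏ q(s) ds` (Richthammer 2007, §5.2). [cite: Richthammer2007, §5.2 (p. 11)] -/
def QFun (k : ℝ) : ℝ := ∫ s in (0 : ℝ)..k, qFun s

/-- `Q(k) > 0` for `k > 0`. [folklore] -/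
theorem QFun_pos {k : ℝ} (hk : 0 < k) : 0 < QFun k :=
  intervalIntegral.intervalIntegral_pos_of_pos (intervalIntegrable_qFun 0 k) qFun_pos hk

/-- `Q` is increasing. [folklore] -/
theorem QFun_mono : Monotone QFun := by
  intro a b hab
  unfold QFun
  rw [← intervalIntegral.integral_add_adjacent_intervals (intervalIntegrable_qFun 0 a)
    (intervalIntegrable_qFun a b)]
  have : 0 ≤ ∫ s in a..b, qFun s := intervalIntegral.integral_nonneg hab fun s _ => (qFun_pos s).le
  linarith

/-- `Q ≥ 0` on `[0, ∞[`. [folklore] -/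
theorem QFun_nonneg {k : ℝ} (hk : 0 ≤ k) : 0 ≤ QFun k :=
  intervalIntegral.integral_nonneg hk fun s _ => (qFun_pos s).le

/-- `Q(k) ≤ k` for `k ≥ 0` (as `q ≤ 1`). [folklore] -/
theorem QFun_le_self {k : ℝ} (hk : 0 ≤ k) : QFun k ≤ k := by
  unfold QFun
  have h := intervalIntegral.integral_mono_on hk (intervalIntegrable_qFun 0 k)
    (intervalIntegrable_const (c := (1 : ℝ))) fun s _ => qFun_le_one s
  simpa using h

/-- On `[e, ∞[` the density is `q(s) = 1/(s log s)`. [folklore] -/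
theorem qFun_eq_of_exp_one_le {s : ℝ} (hs : Real.exp 1 ≤ s) : qFun s = 1 / (s * Real.log s) := by
  refine qFun_eq_of_le_mul_log ?_
  have hlog : 1 ≤ Real.log s := by
    rw [← Real.log_exp 1]
    exact Real.log_le_log (Real.exp_pos 1) hs
  have hs1 : 1 ≤ s := le_trans (by linarith [Real.add_one_le_exp (1 : ℝ)]) hs
  nlinarith

/-- **`log log k ≤ Q(k)`** for `k ≥ e` (§6.8; the printed claim "for `n > 1`" also holds, the
left-hand side being negative on `]1, e[`): `Q(k) ≥ ∫_e^k ds/(s log s) = log log k`.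
[cite: Richthammer2007, §6.8 (p. 17)] -/
theorem loglog_le_QFun {k : ℝ} (hk : Real.exp 1 ≤ k) : Real.log (Real.log k) ≤ QFun k := by
  have he : 0 < Real.exp 1 := Real.exp_pos 1
  -- FTC on `[e, k]` for `log ∘ log`
  have hderiv : ∀ s ∈ Set.uIcc (Real.exp 1) k,
      HasDerivAt (fun s => Real.log (Real.log s)) (1 / (s * Real.log s)) s := by
    intro s hs
    rw [Set.uIcc_of_le hk] at hs
    have hs0 : 0 < s := he.trans_le hs.1
    have hlog : 0 < Real.log s := by
      have : 1 ≤ Real.log s := by rw [← Real.log_exp 1]; exact Real.log_le_log he hs.1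
      linarith
    have h := (Real.hasDerivAt_log hlog.ne').comp s (Real.hasDerivAt_log hs0.ne')
    refine h.congr_deriv ?_
    rw [one_div, mul_inv, mul_comm]
  have hint : IntervalIntegrable (fun s => 1 / (s * Real.log s)) volume (Real.exp 1) k := by
    refine (continuousOn_const.div (continuousOn_id.mul (Real.continuousOn_log.mono ?_)) ?_).intervalIntegrable_of_Icc hk
    · intro s hs
      exact ne_of_gt (he.trans_le hs.1)
    · intro s hs
      have hs0 : 0 < s := he.trans_le hs.1
      have : 1 ≤ Real.log s := by rw [← Real.log_exp 1]; exact Real.log_le_log he hs.1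
      exact ne_of_gt (mul_pos hs0 (by linarith))
  have hftc := intervalIntegral.integral_eq_sub_of_hasDerivAt hderiv hint
  simp only [Real.log_exp, Real.log_one, sub_zero] at hftc
  -- compare with `Q`
  have hsplit : QFun k = (∫ s in (0 : ℝ)..Real.exp 1, qFun s) + ∫ s in Real.exp 1..k, qFun s := by
    unfold QFun
    rw [intervalIntegral.integral_add_adjacent_intervals (intervalIntegrable_qFun _ _)
      (intervalIntegrable_qFun _ _)]
  have h1 : 0 ≤ ∫ s in (0 : ℝ)..Real.exp 1, qFun s :=
    intervalIntegral.integral_nonneg he.le fun s _ => (qFun_pos s).le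
  have h2 : ∫ s in Real.exp 1..k, qFun s = ∫ s in Real.exp 1..k, 1 / (s * Real.log s) := by
    refine intervalIntegral.integral_congr fun s hs => ?_
    rw [Set.uIcc_of_le hk] at hs
    exact qFun_eq_of_exp_one_le hs.1
  rw [hsplit, h2, hftc]
  linarith

/-- **`Q(k) → ∞`** (§6.8). [cite: Richthammer2007, §6.8 (p. 17)] -/
theorem tendsto_QFun_atTop : Tendsto QFun atTop atTop := by
  have h : Tendsto (fun k => Real.log (Real.log k)) atTop atTop :=
    Real.tendsto_log_atTop.comp Real.tendsto_log_atTop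
  refine tendsto_atTop_mono' atTop ?_ h
  filter_upwards [eventually_ge_atTop (Real.exp 1)] with k hk
  exact loglog_le_QFun hk

/-! ### The profile `r` and the translation distance `t_n` -/

/-- `r(s, k) := ∫_{(s ∨ 0) ∧ k}^k q(s') ds' / Q(k)` (Richthammer 2007, §5.2). [cite: Richthammer2007, §5.2 (p. 11)] -/
def rFun (s k : ℝ) : ℝ := (∫ s' in min (max s 0) k..k, qFun s') / QFun k

/-- **The translation distance function** `t_n(s) := τ r(s - R, n - R)` (Richthammer 2007, §5.2;
the parameters `τ ∈ [0, 1/2]`, `R`, `n` of §5.1–5.2 are arguments). [cite: Richthammer2007, §5.2 (p. 11)] -/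
def tProfile (τ R n s : ℝ) : ℝ := τ * rFun (s - R) (n - R)

/-- The lower integration limit `(s ∨ 0) ∧ k` is monotone in `s`. [folklore] -/
theorem clamp_mono {s s' : ℝ} (k : ℝ) (h : s ≤ s') : min (max s 0) k ≤ min (max s' 0) k :=
  min_le_min (max_le_max h le_rfl) le_rfl

/-- The lower integration limit `(s ∨ 0) ∧ k` is `1`-Lipschitz in `s`. [folklore] -/
theorem clamp_sub_clamp_le {s s' : ℝ} (k : ℝ) (h : s ≤ s') :
    min (max s' 0) k - min (max s 0) k ≤ s' - s := by
  have h1 : max s' 0 - max s 0 ≤ s' - s := by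
    rcases le_total s 0 with hs | hs
    · rw [max_eq_right hs]
      rcases le_total s' 0 with hs' | hs'
      · rw [max_eq_right hs']; linarith
      · rw [max_eq_left hs']; linarith
    · rw [max_eq_left hs, max_eq_left (hs.trans h)]
  have h2 : min (max s' 0) k - min (max s 0) k ≤ max s' 0 - max s 0 := by
    have hm : max s 0 ≤ max s' 0 := max_le_max h le_rfl
    rcases le_total (max s 0) k with ha | ha
    · rw [min_eq_left ha]
      exact sub_le_sub_right (min_le_left _ _) _
    · rw [min_eq_right ha, min_eq_right (ha.trans hm)]
      linarith
  linarith

/-- The integral of the decreasing `q` over `[a, b]` is at most `(b - a) q(a)`. [folklore] -/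
theorem integral_qFun_le {a b : ℝ} (hab : a ≤ b) : ∫ s in a..b, qFun s ≤ (b - a) * qFun a := by
  have h := intervalIntegral.integral_mono_on hab (intervalIntegrable_qFun a b)
    (intervalIntegrable_const (c := qFun a)) fun s hs => qFun_antitone hs.1
  rwa [intervalIntegral.integral_const, smul_eq_mul] at h

/-- `0 ≤ r ≤ 1` (for `k > 0`). [cite: Richthammer2007, §5.2 (p. 11)] -/
theorem rFun_mem_Icc {k : ℝ} (hk : 0 < k) (s : ℝ) : rFun s k ∈ Set.Icc (0 : ℝ) 1 := by
  have hQ := QFun_pos hk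
  have hc0 : 0 ≤ min (max s 0) k := le_min (le_max_right _ _) hk.le
  have hck : min (max s 0) k ≤ k := min_le_right _ _
  have hnum0 : 0 ≤ ∫ s' in min (max s 0) k..k, qFun s' :=
    intervalIntegral.integral_nonneg hck fun s _ => (qFun_pos s).le
  have hnum1 : ∫ s' in min (max s 0) k..k, qFun s' ≤ QFun k := by
    unfold QFun
    rw [← intervalIntegral.integral_add_adjacent_intervals (intervalIntegrable_qFun 0 (min (max s 0) k))
      (intervalIntegrable_qFun (min (max s 0) k) k)]
    have : 0 ≤ ∫ s' in (0 : ℝ)..min (max s 0) k, qFun s' :=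
      intervalIntegral.integral_nonneg hc0 fun s _ => (qFun_pos s).le
    linarith
  unfold rFun
  exact ⟨div_nonneg hnum0 hQ.le, (div_le_one hQ).2 hnum1⟩

/-- `r(s, k) = 1` for `s ≤ 0 < k`. [cite: Richthammer2007, §5.2 (5.2) (p. 11)] -/
theorem rFun_eq_one {s k : ℝ} (hs : s ≤ 0) (hk : 0 < k) : rFun s k = 1 := by
  unfold rFun QFun
  rw [max_eq_right hs, min_eq_left hk.le]
  exact div_self (QFun_pos hk).ne'

/-- `r(s, k) = 0` for `s ≥ k`. [cite: Richthammer2007, §5.2 (5.2) (p. 11)] -/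
theorem rFun_eq_zero {s k : ℝ} (hs : k ≤ s) : rFun s k = 0 := by
  unfold rFun
  rw [min_eq_right (hs.trans (le_max_left _ _)), intervalIntegral.integral_same, zero_div]

/-- **(6.15)**: for `u ≤ u'`, `u ≤ k`, `0 < k`:
`0 ≤ r(u, k) - r(u', k) ≤ (u' - u) q(u) / Q(k)` "by the monotonicity of `q`" (printed with
`u = s - R`, `u' = s' - R`, `k = n - R`). [cite: Richthammer2007, §6.8 (6.15) (p. 17)] -/
theorem rFun_sub_rFun_bounds {u u' k : ℝ} (huu' : u ≤ u') (huk : u ≤ k) (hk : 0 < k) :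
    0 ≤ rFun u k - rFun u' k ∧ rFun u k - rFun u' k ≤ (u' - u) * qFun u / QFun k := by
  have hQ := QFun_pos hk
  set c : ℝ := min (max u 0) k with hc
  set c' : ℝ := min (max u' 0) k with hc'
  have hcc' : c ≤ c' := clamp_mono k huu'
  have hdiff : rFun u k - rFun u' k = (∫ s in c..c', qFun s) / QFun k := by
    unfold rFun
    rw [← hc, ← hc', ← intervalIntegral.integral_add_adjacent_intervals (intervalIntegrable_qFun c c')
      (intervalIntegrable_qFun c' k)]
    ring
  rw [hdiff]
  constructor
  · exact div_nonneg (intervalIntegral.integral_nonneg hcc' fun s _ => (qFun_pos s).le) hQ.le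
  · refine div_le_div_of_nonneg_right ((integral_qFun_le hcc').trans ?_) hQ.le
    have h1 : c' - c ≤ u' - u := clamp_sub_clamp_le k huu'
    have h2 : qFun c ≤ qFun u := by
      refine qFun_antitone ?_
      rw [hc, min_eq_left ((max_le huk hk.le))]
      exact le_max_left _ _
    have h3 : 0 ≤ c' - c := sub_nonneg.2 hcc'
    exact mul_le_mul h1 h2 (qFun_pos c).le (h3.trans h1)

/-- **(5.2), first part: `t_n = τ` on `]-∞, R]`.** [cite: Richthammer2007, §5.2 (5.2) (p. 11)] -/
theorem tProfile_eq_of_le {τ R n s : ℝ} (hs : s ≤ R) (hRn : R < n) : tProfile τ R n s = τ := by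
  unfold tProfile
  rw [rFun_eq_one (sub_nonpos.2 hs) (sub_pos.2 hRn), mul_one]

/-- **(5.2), second part: `t_n = 0` on `[n, ∞[`.** [cite: Richthammer2007, §5.2 (5.2) (p. 11)] -/
theorem tProfile_eq_zero_of_le {τ R n s : ℝ} (hs : n ≤ s) : tProfile τ R n s = 0 := by
  unfold tProfile
  rw [rFun_eq_zero (sub_le_sub_right hs R), mul_zero]

/-- `0 ≤ t_n ≤ τ` (for `τ ≥ 0`, `R < n`). [cite: Richthammer2007, §5.2 (p. 11)] -/
theorem tProfile_mem_Icc {τ R n : ℝ} (hτ : 0 ≤ τ) (hRn : R < n) (s : ℝ) :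
    tProfile τ R n s ∈ Set.Icc 0 τ := by
  have h := rFun_mem_Icc (sub_pos.2 hRn) (s - R)
  unfold tProfile
  exact ⟨mul_nonneg hτ h.1, mul_le_of_le_one_right hτ h.2⟩

/-- **(5.2), third part: `t_n` is decreasing** (for `τ ≥ 0`, `R < n`). [cite: Richthammer2007, §5.2 (5.2) (p. 11)] -/
theorem tProfile_antitone {τ R n : ℝ} (hτ : 0 ≤ τ) (hRn : R < n) : Antitone (tProfile τ R n) := by
  intro s s' hss'
  unfold tProfile
  refine mul_le_mul_of_nonneg_left ?_ hτ
  -- `r(s' - R) ≤ r(s - R)`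
  rcases le_or_gt s n with hsn | hsn
  · have h := (rFun_sub_rFun_bounds (sub_le_sub_right hss' R) (sub_le_sub_right hsn R) (sub_pos.2 hRn)).1
    linarith
  · rw [rFun_eq_zero (sub_le_sub_right hsn.le R), rFun_eq_zero (sub_le_sub_right (hsn.le.trans hss') R)]

/-- **The Lipschitz estimate on `t_n` from (6.15)**: for `s ≤ s'` and `s ≤ n`,
`0 ≤ t_n(s) - t_n(s') ≤ τ (s' - s) q(s - R) / Q(n - R)`. [cite: Richthammer2007, §6.8 (6.15) (p. 17)] -/
theorem tProfile_sub_bounds {τ R n s s' : ℝ} (hτ : 0 ≤ τ) (hRn : R < n) (hss' : s ≤ s') (hsn : s ≤ n) :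
    0 ≤ tProfile τ R n s - tProfile τ R n s' ∧
      tProfile τ R n s - tProfile τ R n s' ≤ τ * ((s' - s) * qFun (s - R) / QFun (n - R)) := by
  have h := rFun_sub_rFun_bounds (sub_le_sub_right hss' R) (sub_le_sub_right hsn R) (sub_pos.2 hRn)
  have e : s' - R - (s - R) = s' - s := by ring
  rw [e] at h
  unfold tProfile
  constructor
  · nlinarith [h.1]
  · nlinarith [h.2]

/-- A uniform Lipschitz constant: `|t_n(s) - t_n(s')| ≤ τ |s - s'| / Q(n - R)` (as `q ≤ 1`).
[cite: Richthammer2007, §6.8 (6.15) (p. 17)] -/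
theorem abs_tProfile_sub_le {τ R n : ℝ} (hτ : 0 ≤ τ) (hRn : R < n) (s s' : ℝ) :
    |tProfile τ R n s - tProfile τ R n s'| ≤ τ * |s - s'| / QFun (n - R) := by
  have hQ := QFun_pos (sub_pos.2 hRn)
  -- reduce to `s ≤ s'`
  wlog hss' : s ≤ s' generalizing s s' with H
  · have h := H s' s (le_of_not_ge hss')
    rwa [abs_sub_comm, abs_sub_comm s' s] at h
  rcases le_or_gt s n with hsn | hsn
  · have h := tProfile_sub_bounds hτ hRn hss' hsn
    rw [abs_of_nonneg h.1, abs_of_nonpos (sub_nonpos.2 hss')]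
    calc tProfile τ R n s - tProfile τ R n s' ≤ τ * ((s' - s) * qFun (s - R) / QFun (n - R)) := h.2
      _ ≤ τ * ((s' - s) * 1 / QFun (n - R)) := by
          refine mul_le_mul_of_nonneg_left (div_le_div_of_nonneg_right ?_ hQ.le) hτ
          exact mul_le_mul_of_nonneg_left (qFun_le_one _) (sub_nonneg.2 hss')
      _ = τ * -(s - s') / QFun (n - R) := by ring
  · rw [tProfile_eq_zero_of_le hsn.le, tProfile_eq_zero_of_le (hsn.le.trans hss'), sub_self, abs_zero]
    positivity

end Literature.Barriers.AtomisticToContinuum.HardDisk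

end
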